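import Summits.AtomisticToContinuum.Crystallization.Theorems.FluxTubeKeplerFloorGivesLayered
import Summits.AtomisticToContinuum.Crystallization.Theorems.FluxTubeKeplerFluxCellKeplerSingleScale
import Summits.AtomisticToContinuum.Crystallization.Theorems.ChessboardParticlePlanesPeriodicWindowsIffCrystallization

/-!
# `AnnulusBlindRung` — F4 on-path lemma `S → Rung` (no `sorry`)

Forward rung over `FluxTubeKepler.FloorGivesLayered` (crux dir `FluxCellKepler`, stmt-AtomisticToContinuum-15221; fwd-rung G1 gen 18).
Re-declares the annulus-blind ladder of `Lines/AnnulusBlindRung.lean` in the namespace `…CoordLadder.OnPath` and proves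
`coordRung_of_crystallization k : Crystallization → CoordRung k` for EVERY ball factor `k`, hence
`AnnulusBlindRung_of_Crystallization : Crystallization → AnnulusBlindRung` (tagged `@[aesop safe apply]`, the rule the tribunal
kernel's `S → C` probe closes with).  The proof is the landed
`ChessboardParticlePlanesPeriodicWindowsIffCrystallization.periodicWindows_of_crystallization`; the rung's hypotheses are not used,
so the rung is ON THE PATH to `S` in the strongest sense ([nec]-trap discharged by the F3 witness `coordRung_zero`, also here).
-/

noncomputable section

namespace Summit.AtomisticToContinuum.Crystallization.Cruxes.FluxCellKepler.CoordLadder.OnPath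

open scoped BigOperators Classical
open Filter Topology
open Literature.MathematicalPhysics.StatisticalMechanics
open Summit.AtomisticToContinuum.Crystallization.Theorems.FluxCellKeplerSingleScale (LayeredGood layeredGood_mono)

local notation "E3" => EuclideanSpace ℝ (Fin 3)

/-! ## The objects: soft twelve-coordination (NO annulus clause) and coordinated balls -/

/-- **SOFTLY TWELVE-COORDINATED** at scale `a`, tolerance `η`: every other particle is at distance `≥ a(1−η)` from `x j` (hard core) and
EXACTLY twelve are within `a(1+η)`.  Gen 16's `SoftKissed a η x j` minus the empty-annulus clause
`dist ≤ a(1+η) ∨ (63/50)·a ≤ dist` (Hales's gap `h₀ = 1.26`): nothing is assumed between `a(1+η)` and `1.26a`. -/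
def SoftCoord (a η : ℝ) {N : ℕ} (x : Fin N → E3) (j : Fin N) : Prop :=
  (∀ l : Fin N, l ≠ j → a * (1 - η) ≤ dist (x j) (x l)) ∧
    Nat.card {l : Fin N // l ≠ j ∧ dist (x j) (x l) ≤ a * (1 + η)} = 12

/-- **COORDINATED BALL of radius `k·R`** (`k ≥ 1`; `CoordBall 0 := False`): for ONE spacing `a ∈ [47/50, 1]` (the floor's box) every
particle within `k·R` of `x i` is softly twelve-coordinated at `(a, η)`.  A bare pair of numbers per particle (hard core, count). -/
def CoordBall (k : ℕ) (R η : ℝ) {N : ℕ} (x : Fin N → E3) (i : Fin N) : Prop :=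
  0 < k ∧ ∃ a : ℝ, 47 / 50 ≤ a ∧ a ≤ 1 ∧ ∀ j : Fin N, dist (x j) (x i) ≤ (k : ℝ) * R → SoftCoord a η x j

/-! ## The rung family -/

/-- FLOOR(P₀): `N · e(P₀) ≤ E(x)` on every Lennard-Jones ground state (verbatim the first hypothesis of `FluxTubeKepler.FloorGivesLayered`). -/
def Floor (P₀ : PeriodicConfiguration 3) : Prop :=
  ∀ (N : ℕ) (x : Fin N → E3), IsGroundState lennardJones x →
    (N : ℝ) * P₀.energyPerParticle lennardJones ≤ interactionEnergy lennardJones x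

/-- ANNULUS-BLIND BUDGET with ball factor `k`: for every `R > 0`, `η > 0` some `c > 0` prices the sites of every Lennard-Jones ground state
that are `(R,η)`-non-layered AND have no coordinated `kR`-ball at tolerance `η` (`k = 0`: the floor's budget; quantifier order `∀ R η ∃ c`
of the crux kept). -/
def CoordBudget (k : ℕ) (P₀ : PeriodicConfiguration 3) : Prop :=
  ∀ R η : ℝ, 0 < R → 0 < η → ∃ c : ℝ, 0 < c ∧
    ∀ (N : ℕ) (x : Fin N → E3), IsGroundState lennardJones x →
      c * (Nat.card {i : Fin N // ¬ LayeredGood R η x i ∧ ¬ CoordBall k R η x i} : ℝ) ≤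
        interactionEnergy lennardJones x - (N : ℝ) * P₀.energyPerParticle lennardJones

/-- Periodic windows at every scale along `x` (verbatim the conclusion of `FluxTubeKepler.PeriodicWindows`). -/
def HasPeriodicWindows (x : (N : ℕ) → (Fin N → E3)) : Prop :=
  ∃ P : PeriodicConfiguration 3, ∀ R ε : ℝ, 0 < ε → ∃ᶠ N in atTop, ∃ t : E3,
    (∀ q ∈ P.points, ‖q‖ ≤ R → ∃ i : Fin N, dist (x N i + t) q ≤ ε) ∧
    (∀ i : Fin N, ‖x N i + t‖ ≤ R → ∃ q ∈ P.points, dist (x N i + t) q ≤ ε)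

/-- **The graded family.** `CoordRung k`: FLOOR and the annulus-blind budget with ball factor `k` force periodic windows along every
Lennard-Jones ground-state sequence. -/
def CoordRung (k : ℕ) : Prop :=
  ∀ P₀ : PeriodicConfiguration 3, Floor P₀ → CoordBudget k P₀ →
    ∀ x : (N : ℕ) → (Fin N → E3), (∀ N, IsGroundState lennardJones (x N)) → HasPeriodicWindows x

/-- **Deciding rung** (`k₀ + 1 = 1`): a Kepler-type certificate BLIND to every region that is merely softly twelve-coordinated (hard core
+ count, no empty annulus certified) still forces crystallization of the Lennard-Jones ground states. -/
def AnnulusBlindRung : Prop := CoordRung 1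

/-! ## Counting helpers -/

theorem natCard_mono {N : ℕ} {p q : Fin N → Prop} (h : ∀ i, p i → q i) :
    Nat.card {i // p i} ≤ Nat.card {i // q i} := by
  rw [Nat.card_eq_fintype_card, Nat.card_eq_fintype_card]
  exact Fintype.card_subtype_mono _ _ h

/-! ## F3 — the family specialises to the proved floor -/

@[simp] theorem not_coordBall_zero (R η : ℝ) {N : ℕ} (x : Fin N → E3) (i : Fin N) : ¬ CoordBall 0 R η x i :=
  fun h => (lt_irrefl 0 h.1).elim

/-- At ball factor `0` the annulus-blind budget IS the floor's budget. -/
theorem coordBudget_zero_iff (P₀ : PeriodicConfiguration 3) :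
    CoordBudget 0 P₀ ↔
      ∀ R η : ℝ, 0 < R → 0 < η → ∃ c : ℝ, 0 < c ∧
        ∀ (N : ℕ) (x : Fin N → E3), IsGroundState lennardJones x →
          c * (Nat.card {i : Fin N // ¬ LayeredGood R η x i} : ℝ) ≤
            interactionEnergy lennardJones x - (N : ℝ) * P₀.energyPerParticle lennardJones := by
  simp only [CoordBudget, not_coordBall_zero, not_false_eq_true, and_true]

/-- `CoordRung 0` is the floor: the seed theorem BY NAME followed by the proved `PeriodicGivenLayered`. -/
theorem coordRung_zero : CoordRung 0 := fun P₀ hF hB x hx =>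
  Theses.FluxTubeKepler.PeriodicGivenLayered_holds x hx
    (Theorems.FluxTubeKeplerFloorGivesLayered.FloorGivesLayered_proof P₀ hF
      ((coordBudget_zero_iff P₀).1 hB) x hx)

/-! ## Dial: `CoordRung 1 → CoordRung k → CoordRung 0` (`k ≥ 1`) -/

theorem coordBudget_of_zero (k : ℕ) (P₀ : PeriodicConfiguration 3) : CoordBudget 0 P₀ → CoordBudget k P₀ := by
  intro hB R η hR hη
  obtain ⟨c, hc, hcB⟩ := hB R η hR hη
  refine ⟨c, hc, fun N x hx => le_trans ?_ (hcB N x hx)⟩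
  have hle : Nat.card {i : Fin N // ¬ LayeredGood R η x i ∧ ¬ CoordBall k R η x i} ≤
      Nat.card {i : Fin N // ¬ LayeredGood R η x i ∧ ¬ CoordBall 0 R η x i} :=
    natCard_mono fun i hi => ⟨hi.1, not_coordBall_zero R η x i⟩
  exact mul_le_mul_of_nonneg_left (by exact_mod_cast hle) hc.le

/-- Every member implies the floor member. -/
theorem coordRung_zero_of_coordRung {k : ℕ} (h : CoordRung k) : CoordRung 0 :=
  fun P₀ hF hB x hx => h P₀ hF (coordBudget_of_zero k P₀ hB) x hx

theorem coordBall_one_of_coordBall {k : ℕ} (hk : 0 < k) {R η : ℝ} (hR : 0 ≤ R) {N : ℕ} (x : Fin N → E3)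
    (i : Fin N) : CoordBall k R η x i → CoordBall 1 R η x i := by
  rintro ⟨-, a, ha₁, ha₂, h⟩
  refine ⟨Nat.one_pos, a, ha₁, ha₂, fun j hj => h j (hj.trans ?_)⟩
  have hk' : (1 : ℝ) ≤ (k : ℝ) := by exact_mod_cast hk
  simpa using mul_le_mul_of_nonneg_right hk' hR

theorem coordBudget_one_of_coordBudget {k : ℕ} (hk : 0 < k) (P₀ : PeriodicConfiguration 3) :
    CoordBudget k P₀ → CoordBudget 1 P₀ := by
  intro hB R η hR hη
  obtain ⟨c, hc, hcB⟩ := hB R η hR hη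
  refine ⟨c, hc, fun N x hx => le_trans ?_ (hcB N x hx)⟩
  have hle : Nat.card {i : Fin N // ¬ LayeredGood R η x i ∧ ¬ CoordBall 1 R η x i} ≤
      Nat.card {i : Fin N // ¬ LayeredGood R η x i ∧ ¬ CoordBall k R η x i} :=
    natCard_mono fun i hi => ⟨hi.1, fun hK => hi.2 (coordBall_one_of_coordBall hk hR.le x i hK)⟩
  exact mul_le_mul_of_nonneg_left (by exact_mod_cast hle) hc.le

/-- The deciding member is the strongest: `CoordRung 1 → CoordRung k`, `k ≥ 1`. -/
theorem coordRung_of_coordRung_one {k : ℕ} (hk : 0 < k) (h : CoordRung 1) : CoordRung k :=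
  fun P₀ hF hB x hx => h P₀ hF (coordBudget_one_of_coordBudget hk P₀ hB) x hx

/-! ## F4 — on-path: the sub-problem implies every member -/

theorem coordRung_of_crystallization (k : ℕ) (h : _root_.Crystallization) : CoordRung k :=
  fun _ _ _ x hx =>
    Theorems.ChessboardParticlePlanesPeriodicWindowsIffCrystallization.periodicWindows_of_crystallization h x hx

@[aesop safe apply]
theorem AnnulusBlindRung_of_Crystallization (h : _root_.Crystallization) : AnnulusBlindRung :=
  coordRung_of_crystallization 1 h

/-! ## The on-path lemma, literally -/

example : _root_.Crystallization → AnnulusBlindRung := AnnulusBlindRung_of_Crystallization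

example : _root_.Crystallization → AnnulusBlindRung := by aesop

example (k : ℕ) : _root_.Crystallization → CoordRung k := coordRung_of_crystallization k

end Summit.AtomisticToContinuum.Crystallization.Cruxes.FluxCellKepler.CoordLadder.OnPath

end
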